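import Literature.MathematicalPhysics.QuantumFieldTheory.Balaban1983to89.B9Eq3132RingInverseReading
import Literature.MathematicalPhysics.QuantumFieldTheory.Balaban1983to89.B9RecordDELettersVacuity

/-!
# `Balaban1983to89.B9Eq3132SectDLetters` — [B9] Sect. D pp. 419–422: the LETTERS behind (3.132) on NODE 00's carriers —
# `Δ_π(U)` (3.119), `G̃⁻¹(U) = Δ_π + DRD* + Q*aQ` (3.122), Sect. D's `G(U)`, `(QGQ*)(U)`, `(QGQ*)⁻¹(U)` (3.123)∕(3.132) and
# `H(U) = GQ*(QGQ*)⁻¹` (3.126) — over def-Y's v2 family, their `U = 1` faces, and ROW 26 of the N06 knit at these GENUINE letters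

T. Bałaban, *Propagators for lattice gauge theories in a background field*, Commun. Math. Phys. **99** (1985) 389–434
[`Balaban1985BackgroundPropagators`, "B9"]; [4] = T. Bałaban, *Propagators and renormalization transformations for lattice
gauge theories. II*, Commun. Math. Phys. **96** (1984) 223–250 [`Balaban1984PropagatorsII`].  PDF held:
`paper:balaban1985-cmp99-background-propagators` (journal page = PDF page + 388); pp. 416–423 read by this seat in the held text layer.

statement-level skeleton of published theorems with citation tags; proofs where landed; nothing here is a claim about the
Yang–Mills mass gap

THE PRINT (verbatim).  p. 419, (3.118)–(3.119): *"We define a new quadratic form extending ⟨A, ΔA⟩ in a gauge invariant way to all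
configurations A. … ⟨A, Δ_π A⟩ = ⟨A − DG′RD*A, Δ(A − DG′RD*A)⟩. (3.119) The quadratic form is invariant with respect to gauge
transformations determined by λ ∈ N(Q′). … In fact the expression A − DG′RD*A has this invariance property."*  p. 420, (3.122)–(3.123):
*"G̃⁻¹ defined as G̃⁻¹ = Δ_π + DRD* + Q*aQ. … hence A = G̃Q*ω, QG̃Q*ω = B, ω = (QG̃Q*)⁻¹B … HB = … = G̃Q*(QG̃Q*)⁻¹B − DG′RD*G̃Q*(QG̃Q*)⁻¹B.
(3.123)"*; (3.126): *"HB = G̃Q*(QG̃Q*)⁻¹B. (3.126)"*; p. 421: *"Let us denote for a moment the operator we have investigated in previous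
sections by G₀, i.e. G₀ = (Δ + DRD* + Q*aQ)⁻¹"* (so Sect. D's G := G̃); p. 422: *"The operators (QGQ*)⁻¹, or (QG₁Q*)⁻¹, can be analyzed in
the same way as the operator (Q′G′²Q′*)⁻¹. We will not repeat these considerations here, let us write only bounds. We have
|(QGQ*)⁻¹(y, y′)| ≤ O(1)(L^jη)⁻²(L^{j′}η)^{−d}e^{−δ₁d(y,y′)} for y ∈ Λ_j, y′ ∈ Λ_{j′}, (3.132) and the same for the operator with G₁ instead
of G."*

WHY THIS FILE (cell context).  Row 26 of the N06 knit (`s3132 : B9.Stmt3132Printed …`, N06-ASSIGNMENT v1, bundle F4) reads the letters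
`CovLettersY.QGQinv ∕ QG1Qinv` of def-Y's family (`Node00.OpsYOfLetters`, p464552) through `siteKernelOfOp … id id`.  In def-Y's v2 family
of record (`Node00.covLettersY_v2`, `lettersYOfRecord`, p484082) these Sect. D letters are the FLAT `0` PLACEHOLDERS, so row 26 is VACUOUS
at `opsYOfRecord` (`B9RecordDELettersVacuity.s3132_opsYOfRecord_vacuous`, p485502) — although EVERY INGREDIENT of the printed formulas
(3.119), (3.122), (3.123), (3.126) is a typed letter of p484082: `gradY U = D_U`, `divY U = D*_U`, `hessY U = Δ(U)`, `RY parS Gp U = R(U)` (3.25),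
`QY ∕ QsY parB U = Q(U) ∕ Q*(U)`, `aY`, and the `G′` letter `Gp`.  THIS FILE assembles them:

* §1 two flat identities of r03's lattice calculus read on the flat kernels: `curlK_mul_gradK : ∂ᶜ♯ · ∂♯ = 0` (`B6SectACriticalPointV1.dcE_comp_dE`)
  and `divK_mul_cocurlK : ∂*♯ · ∂ᶜ*♯ = 0` (`dsE_comp_dcsE`).
* §2 THE LETTERS, on an index `i`, parameters `(parS, parB, Gp)` exactly like def-Y's `deltaAY ∕ GAY`: `gaugePiY i parS Gp U :=
  1 − D_U ∘ G′(U) ∘ R(U) ∘ D*_U` (print's «A − DG′RD*A»); `gaugePiTY … := 1 − D_U ∘ R(U) ∘ G′(U) ∘ D*_U` (its formal adjoint in print's Hilbert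
  space, where D* is the adjoint of D and G′, R are self-adjoint: (DG′RD*)* = DRG′D*); ★ `deltaPiY i parS Gp U := gaugePiTY U ∘ Δ(U) ∘ gaugePiY U`
  — THE OPERATOR OF THE FORM (3.119); ★ `deltaPiAY i parS parB Gp U := Δ_π(U) + D_U R(U) D*_U + Q*(U) a Q(U)` — print's `G̃⁻¹` (3.122);
  ★ `GDY i parS parB Gp : BondOpY 𝔸 i := U ↦ Ring.inverse (deltaPiAY … U)` — Sect. D's `G = G̃` (the genuine inverse where `G̃⁻¹(U)` is a unit,
  `0` elsewhere; the letter `B9.Thm312Printed` calls `GD`); ★ `QGQY … U := Q(U) ∘ G(U) ∘ Q*(U)` on coarse (index-)bond functions;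
  ★★ `QGQinvY … U := Ring.inverse (QGQY … U)` — THE LETTER `(QGQ*)⁻¹(U)` OF (3.123)∕(3.132); ★ `HDY … U := G(U) ∘ Q*(U) ∘ (QGQ*)⁻¹(U)` — (3.126);
  the unit laws `deltaPiAY_mul_GDY ∕ GDY_mul_deltaPiAY ∕ QGQY_mul_QGQinvY ∕ QGQinvY_mul_QGQY` and `QY_comp_HDY` (`Q ∘ H = 1` where `QGQ*` is a
  unit: H solves `QA = B`, (3.110)).
* §3 AT `U = 1` (hypotheses = the record's clauses `parS_one ∕ parB_one ∕ Gp_one`, as in p484082 §5): `gaugePiY_one ∕ gaugePiTY_one` (lifts of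
  `1 − ∂♯G′♯R♯∂*♯` ∕ `1 − ∂♯R♯G′♯∂*♯`), ★★ `deltaPiY_one : Δ_π(1) = Δ(1)` — THE GAUGE-INVARIANT EXTENSION OF THE FLAT FORM IS THE FLAT FORM
  (`∂ᶜ∂ = 0`: at `U = 1` the form `⟨A, ∂ᶜ*∂ᶜA⟩` is already invariant under `A ↦ A − ∂λ`), `deltaPiAY_one : G̃⁻¹(1) = Δ_a(1)`, ★ `GDY_one :
  G(1) = G_A(1)` (so `= Gop♯`, r03's `Δ_a⁻¹` of (2.129): `GDY_one_liftEndY`, and the product-form clause `GDY_one_liftY`), `isUnit_deltaPiAY_one`,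
  `QGQY_one` (`(QGQ*)(1)` = the lift of `Q♯ · [Gop] · Q*♯`) and — print's Cor. 3.5 clause «for U = 1 these theorems are proved in [4]» for the
  operators behind (3.132) and (3.126) — ★ `QGQY_one_liftEndY ∕ _liftY` (`(QGQ*)(1)` = the lift of [4]'s `QGQ*` of (2.35), r03's `qgqE`),
  `isUnit_onFun_qgqE`, ★ `isUnit_QGQY_one` (so at `U = 1` the `Ring.inverse` IS the inverse), ★★ `QGQinvY_one_liftEndY ∕ _liftY` (`(QGQ*)⁻¹(1)` =
  the lift of [4]'s `(QGQ*)⁻¹` of (2.35), r03's `EE` — the `U = 1` CLAUSE of row 26's letter, by n06-g's engine `eq_liftEndY_of_ringInverse`),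
  ★ `HDY_one` (`H(1)` = the lift of [4]'s `H = GQ*(QGQ*)⁻¹` of (2.35)∕(2.130), the operator of `B6Cor28KLevelV1.QE_comp_H ∕ H_entry_le`).
* §4 THE RECORD UPDATE `withSectD 𝔸 𝔏 : CovLettersY 𝔸 x` (replace `GD`, `QGQinv`, `H` by the §2 letters over the record's own `parS, parB, Gp`;
  every other field — in particular the clauses and `G₁ ∕ H₁ ∕ QG1Qinv ∕ GG ∕ Kdiff ∕ Ck ∕ P349` — unchanged) with `rfl` field lemmas, and
  ★ `lettersYSectD N θ M⋆ : LettersY N θ M⋆ := x ↦ withSectD (lettersYOfRecord N θ M⋆ x)` — def-Y's letters of record WITH the genuine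
  row-26 ∕ row-20 letters `(QGQ*)⁻¹`, `G`, `H` (a NAME; whether `lettersYOfRecord` v3 := this is def-Y's ∕ the knit's call).
* §5 ROW 26 AT THESE LETTERS: the per-kernel half `Half3132 d c35 geo bg K` of `B9.Stmt3132Printed` with `half3132_left ∕ _right`,
  `stmt3132Printed_of_halves` (constants merged by g0's `B9Eq3132Whole.ineq3132_mono`; needs `L^jη ≥ 0`, `d ≥ 0`), `half3132_of_ker_zero`;
  `half3132_geo9Y_of_ringInverse` (g4's `stmt3132Printed_geo9Y_of_ringInverse` on the diagonal); the readings `opsYOfLetters_withSectD_QGQinv ∕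
  _QG1Qinv` (`rfl`); ★★ `s3132_withSectD` — for ANY base family `𝔏`, row 26 at `x ↦ withSectD (𝔏 x)` from `hco` + `hdec` for the genuine `(QGQ*)(U)`
  over `(𝔏 x).parS ∕ parB ∕ Gp` plus the displayed `Half3132` of `𝔏`'s own `(QG₁Q*)⁻¹`; ★★★ `s3132_lettersYSectD` — `B9.Stmt3132Printed d′ c35 geo9Y
  (bg9Y …) (x ↦ (opsYOfLetters N θ M⋆ (lettersYSectD N θ M⋆) 𝔈 x).QGQinv) (x ↦ (…).QG1Qinv)` FROM EXACTLY TWO BINDERS: `hco` (Thm 3.11-type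
  coercivity) and `hdec` (Thm 3.3-type decay) of the normalised real matrix `normMatY b w ((QGQ*)(U))` of the GENUINE `(QGQ*)(U)`, symmetric weights
  `w(y) = (Lʲη)^{−(1+d′∕2)}`; the `(QG₁Q*)⁻¹` half is the flat letter (reading `0`, vacuous — LOCATED: `G₁` (3.128) needs the second-order
  averaging term `C^{(2)}` of [5] (149) and `J = D*η⁻² Im ∂U` of (3.12), neither typed on NODE 00's carriers; likewise `H₁`).

MODEL ∕ DECLARED READINGS.  (M1)–(M3) of p484082 inherited (any complete normed ℂ-algebra `𝔸`, `𝔸ˣ`-valued `U`, taxicab transport contours,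
`Ring.inverse` for every inverse).  (M4) ADJOINTS: print's `Δ_π` is the operator of the form (3.119), i.e. `(1 − DG′RD*)*Δ(1 − DG′RD*)` with the
Hilbert adjoint; here the left factor is the EXPLICIT formula `1 − DRG′D*` that the adjoint equals in print's setting (`(D_U)* = D*_U` (3.8), `G′`
symmetric, `R` an orthogonal projection, p. 394) — a polynomial in the letters, hence the reading that extends analytically to the complex
backgrounds of (3.37)–(3.38); no transpose ∕ Hilbert structure on NODE 00's carriers is constructed or needed.  (M5) NOT HERE: any estimate
((3.42)–(3.48), (3.132)–(3.133), Thms 3.1–3.15); the symmetry ∕ gauge-mode annihilation of `Δ_π` (typed on OTHER carriers by the pub-balaban NE9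
chain: `B9Eq3119InvariantExtension`, `B9Eq3119DeltaPiTower.piOfUk ∕ deltaPiOfUk ∕ laplaceAkPi`, `B11Eq103H1Complex.KinvLatticeK`,
`B9Eq3132QGtildeQInvLetterClosed` — cited as analogues, not importable to `FBondY ∕ IBondY`, nothing of theirs restated); `G₁`, `H₁`, `(QG₁Q*)⁻¹`,
`𝔾`, `G(Ω) − G(Ω′)`, `C^{(k)}`, `P` (rows 21–25's letters).
HONEST SCOPE.  Exact finite-dimensional lattice algebra realising printed FORMULAS as functions of `U`, with the `U = 1` identifications PROVED;
row 26's display at genuine letters is BOOKKEEPING — the two estimates REMAIN HYPOTHESES (located: Thm 3.11 p. 416 ∕ Thm 3.3 p. 399 + [4]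
(2.60); print's own route «the same way as (Q′G′²Q′*)⁻¹» = Sect. B is not typed); NOT a node discharge, NOT summit progress (route
BalabanUVNodes: N06 obligations are hypotheses of the knit); one finite lattice programme; nothing continuum, nothing about the mass gap.
Cell `pub-ymgap` (HUMAN RULING D-0062), Track A node N06 [B9], N06-ASSIGNMENT v1 row 26 (bundle F4), seat `pub-ymgap-dag-n06-i` gen 5,
2026-08-27; a NEW file; nothing landed is modified.  Net new unproved facts: 0.
-/

namespace Literature.MathematicalPhysics.QuantumFieldTheory.Balaban1983to89.B9Eq3132SectDLetters

open Node00
open B6KLevelCensusIndexV1 (KIdx)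
open B6SectAOperatorsV1 (dE dsE dcE dcsE)
open B6SectACriticalPointV1 (dcE_comp_dE dsE_comp_dcsE)
open B6Cor28KLevelV1 (onFun_comp)
open B6Ineq2133TwoScaleV1 (onFun onFun_apply)
open B6SectAVectorModelV1 (qgqE EE comp_EE EE_comp)
open B6AgreeLapV1Chart (onFun_id)
open B6GlobalChartV1 (PV domT boxEquiv)
open B6Prop26Census2136KLevelV1 (Gop)
open B9Cor35AtOneInverseLetters (eq_liftEndY_of_ringInverse isUnit_liftEndY)
open B9PinMembersKLevelV1 (MemberY geo9Y bg9Y)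
open B9GeoLemma21KLevelV1 (geo9Y_len_pos geo9K_dist_nonneg')
open B9Eq3132Whole (ineq3132_mono)
open B9Eq3132CTInputs (CoerciveUnder DecayUnder)
open B9Eq3132ScalarIndex (geoComap)
open B9Eq3132RingInverseReading (normMatY stmt3132Printed_geo9Y_of_ringInverse)
open B9RecordDELettersVacuity (siteKernelOfOp_zero_ker stmt3132Printed_of_ker_zero)
open B7Prop2SpecialUnitary (specialUnitaryUnits)
open scoped Matrix

noncomputable section

variable {d ℓ : ℕ} {hd : 1 ≤ d + 1} {hL : Odd (ℓ + 1) ∧ 1 < ℓ + 1} {b₀ b₁ : ℝ} {Mstar : ℕ}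
variable {𝔸 : Type} [NormedRing 𝔸] [NormedAlgebra ℂ 𝔸] [CompleteSpace 𝔸]

/-! ## §1 Two flat identities: `∂ᶜ∂ = 0` and `∂*∂ᶜ* = 0` on the flat kernels -/

section Flat

variable (i : KIdx d ℓ hd hL b₀ b₁)

/-- r03's transport of the zero map is zero. [folklore] -/
private theorem onFun_zero {ι κ : Type} : onFun (0 : EuclideanSpace ℝ ι →ₗ[ℝ] EuclideanSpace ℝ κ) = 0 := by
  rw [onFun, LinearMap.zero_comp, LinearMap.comp_zero]

/-- **`∂ᶜ♯ · ∂♯ = 0`**: the curl kernel annihilates the gradient kernel (r03's `dcE ∘ dE = 0`, [4] p. 224 «invariant with respect to gauge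
transformations»). [cite: Balaban1984PropagatorsII, (2.5)–(2.7) p.224; Balaban1985BackgroundPropagators, (3.3)–(3.4) pp.390–391] -/
theorem curlK_mul_gradK : curlK i * gradK i = 0 := by
  have hprod : LinearMap.toMatrix' (onFun (dcE (P := PV d ℓ i.m i.K hd hL) i.cf)) *
      LinearMap.toMatrix' (onFun (dE (P := PV d ℓ i.m i.K hd hL) i.cf)) = 0 := by
    rw [← LinearMap.toMatrix'_comp, ← onFun_comp, dcE_comp_dE, onFun_zero, map_zero]
  ext p z
  have h := congrFun (congrFun hprod p) ((boxEquiv i.hN).symm z)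
  rw [Matrix.mul_apply] at h ⊢
  exact h

/-- **`∂*♯ · ∂ᶜ*♯ = 0`**: the divergence kernel annihilates the co-curl kernel (r03's `dsE ∘ dcsE = 0`).
[cite: Balaban1984PropagatorsII, (2.32) p.227; Balaban1985BackgroundPropagators, (3.8)–(3.9) p.392] -/
theorem divK_mul_cocurlK : divK i * cocurlK i = 0 := by
  have hprod : LinearMap.toMatrix' (onFun (dsE (P := PV d ℓ i.m i.K hd hL) i.cf)) *
      LinearMap.toMatrix' (onFun (dcsE (P := PV d ℓ i.m i.K hd hL) i.cf)) = 0 := by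
    rw [← LinearMap.toMatrix'_comp, ← onFun_comp, dsE_comp_dcsE, onFun_zero, map_zero]
  ext z p
  have h := congrFun (congrFun hprod ((boxEquiv i.hN).symm z)) p
  rw [Matrix.mul_apply] at h ⊢
  exact h

end Flat

/-! ## §2 The letters: `1 − DG′RD*`, `Δ_π(U)` (3.119), `G̃⁻¹(U)` (3.122), Sect. D's `G(U)`, `(QGQ*)(U)`, `(QGQ*)⁻¹(U)`, `H(U)` (3.126) -/

section Letters

variable (i : KIdx d ℓ hd hL b₀ b₁)

/-- **print's `A ↦ A − D_U G′(U) R(U) D*_U A`** (p. 419: «the expression A − DG′RD*A has this invariance property … It is obtained by gauge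
transforming an arbitrary configuration A to the subspace {A : RD*A = 0}»), over the letters `gradY`, `Gp`, `RY`, `divY`.
[cite: Balaban1985BackgroundPropagators, (3.119) p.419] -/
def gaugePiY (parS : SiteParY 𝔸 i) (Gp : SiteOpY 𝔸 i) (U : CfgY 𝔸 i) : (FBondY i → 𝔸) →ₗ[ℂ] (FBondY i → 𝔸) :=
  LinearMap.id - gradY i U ∘ₗ Gp U ∘ₗ RY i parS Gp U ∘ₗ divY i U

/-- **`1 − D_U R(U) G′(U) D*_U`** — the formal adjoint of `gaugePiY` in print's Hilbert space (`(D_U)* = D*_U` (3.8), `G′ = (Δ′_a)⁻¹` symmetric,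
`R` an orthogonal projection (3.25): `(DG′RD*)* = DRG′D*`), as an explicit polynomial in the letters.
[cite: Balaban1985BackgroundPropagators, (3.119) p.419, (3.8) p.392, (3.25) p.394] -/
def gaugePiTY (parS : SiteParY 𝔸 i) (Gp : SiteOpY 𝔸 i) (U : CfgY 𝔸 i) : (FBondY i → 𝔸) →ₗ[ℂ] (FBondY i → 𝔸) :=
  LinearMap.id - gradY i U ∘ₗ RY i parS Gp U ∘ₗ Gp U ∘ₗ divY i U

/-- ★ **`Δ_π(U) := (1 − DRG′D*) ∘ Δ(U) ∘ (1 − DG′RD*)` — THE OPERATOR OF THE GAUGE-INVARIANT EXTENSION (3.119)** `⟨A, Δ_π A⟩ =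
⟨A − DG′RD*A, Δ(A − DG′RD*A)⟩` of the Hessian form (3.10) (`hessY U = Δ(U)`). [cite: Balaban1985BackgroundPropagators, (3.119) p.419, (3.10) p.392] -/
def deltaPiY (parS : SiteParY 𝔸 i) (Gp : SiteOpY 𝔸 i) (U : CfgY 𝔸 i) : (FBondY i → 𝔸) →ₗ[ℂ] (FBondY i → 𝔸) :=
  gaugePiTY i parS Gp U ∘ₗ hessY i U ∘ₗ gaugePiY i parS Gp U

/-- ★ **`G̃⁻¹(U) := Δ_π(U) + D_U R(U) D*_U + Q*(U) a Q(U)` — (3.122)** (print's «G̃⁻¹ defined as G̃⁻¹ = Δ_π + DRD* + Q*aQ»; compare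
`deltaAY … U = Δ(U) + DRD* + Q*aQ` (3.26), print's `G₀⁻¹` of p. 421). [cite: Balaban1985BackgroundPropagators, (3.122) p.420, (3.26) p.395] -/
def deltaPiAY (parS : SiteParY 𝔸 i) (parB : BondParY 𝔸 i) (Gp : SiteOpY 𝔸 i) (U : CfgY 𝔸 i) :
    (FBondY i → 𝔸) →ₗ[ℂ] (FBondY i → 𝔸) :=
  deltaPiY i parS Gp U + gradY i U ∘ₗ RY i parS Gp U ∘ₗ divY i U + QsY i parB U ∘ₗ aY i ∘ₗ QY i parB U

/-- ★ **SECT. D's `G(U) := G̃(U) = (Δ_π + DRD* + Q*aQ)⁻¹(U)`** (p. 421: the Sect. A–C operator is renamed `G₀`), total in `Module.End ℂ`: the genuine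
inverse where `G̃⁻¹(U)` is a unit (Thm 3.12's regime, NOT claimed), `0` elsewhere.  The letter `B9.Thm312Printed` calls `GD` and the `G` of
`(QGQ*)⁻¹` (3.132) and of `H = GQ*(QGQ*)⁻¹` (3.126). [cite: Balaban1985BackgroundPropagators, (3.122)–(3.123) p.420, Thm 3.12 p.423] -/
def GDY (parS : SiteParY 𝔸 i) (parB : BondParY 𝔸 i) (Gp : SiteOpY 𝔸 i) : BondOpY 𝔸 i :=
  fun U => Ring.inverse (deltaPiAY i parS parB Gp U)

/-- ★ **`(QGQ*)(U) := Q(U) ∘ G(U) ∘ Q*(U)`** on coarse-bond (index-bond) functions — the operator of «QG̃Q*ω = B» (3.123).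
[cite: Balaban1985BackgroundPropagators, (3.123) p.420, (3.132) p.422] -/
def QGQY (parS : SiteParY 𝔸 i) (parB : BondParY 𝔸 i) (Gp : SiteOpY 𝔸 i) (U : CfgY 𝔸 i) : (IBondY i → 𝔸) →ₗ[ℂ] (IBondY i → 𝔸) :=
  QY i parB U ∘ₗ GDY i parS parB Gp U ∘ₗ QsY i parB U

/-- ★★ **THE LETTER `(QGQ*)⁻¹(U)` OF (3.123)∕(3.132)**: `Ring.inverse ((QGQ*)(U))` — the genuine inverse where `(QGQ*)(U)` is a unit, `0`
elsewhere; the letter `CovLettersY.QGQinv` that row 26 (`B9.Stmt3132Printed`) reads through `siteKernelOfOp … id id`.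
[cite: Balaban1985BackgroundPropagators, (3.123) p.420 («ω = (QG̃Q*)⁻¹B»), (3.132) p.422] -/
def QGQinvY (parS : SiteParY 𝔸 i) (parB : BondParY 𝔸 i) (Gp : SiteOpY 𝔸 i) (U : CfgY 𝔸 i) :
    (IBondY i → 𝔸) →ₗ[ℂ] (IBondY i → 𝔸) :=
  Ring.inverse (QGQY i parS parB Gp U)

/-- ★ **`H(U) := G(U) ∘ Q*(U) ∘ (QGQ*)⁻¹(U)` — (3.126)** «HB = G̃Q*(QG̃Q*)⁻¹B», from coarse-bond functions to fine-bond functions (the letter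
`CovLettersY.H` of `B9.Thm312Printed`'s (3.133) conjunct). [cite: Balaban1985BackgroundPropagators, (3.126) p.420] -/
def HDY (parS : SiteParY 𝔸 i) (parB : BondParY 𝔸 i) (Gp : SiteOpY 𝔸 i) (U : CfgY 𝔸 i) : (IBondY i → 𝔸) →ₗ[ℂ] (FBondY i → 𝔸) :=
  GDY i parS parB Gp U ∘ₗ QsY i parB U ∘ₗ QGQinvY i parS parB Gp U

variable {i}
variable {parS : SiteParY 𝔸 i} {parB : BondParY 𝔸 i} {Gp : SiteOpY 𝔸 i} {U : CfgY 𝔸 i}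

/-- `Δ_π(U)` unfolded. [cite: Balaban1985BackgroundPropagators, (3.119) p.419, bookkeeping] -/
theorem deltaPiY_eq : deltaPiY i parS Gp U =
    (LinearMap.id - gradY i U ∘ₗ RY i parS Gp U ∘ₗ Gp U ∘ₗ divY i U) ∘ₗ hessY i U ∘ₗ
      (LinearMap.id - gradY i U ∘ₗ Gp U ∘ₗ RY i parS Gp U ∘ₗ divY i U) := rfl

/-- `G̃⁻¹(U)·G(U) = 1` wherever `G̃⁻¹(U)` is invertible. [cite: Balaban1985BackgroundPropagators, (3.122) p.420] -/
theorem deltaPiAY_mul_GDY (hU : IsUnit (deltaPiAY i parS parB Gp U)) : deltaPiAY i parS parB Gp U * GDY i parS parB Gp U = 1 :=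
  Ring.mul_inverse_cancel _ hU

/-- `G(U)·G̃⁻¹(U) = 1` wherever `G̃⁻¹(U)` is invertible. [cite: Balaban1985BackgroundPropagators, (3.122) p.420] -/
theorem GDY_mul_deltaPiAY (hU : IsUnit (deltaPiAY i parS parB Gp U)) : GDY i parS parB Gp U * deltaPiAY i parS parB Gp U = 1 :=
  Ring.inverse_mul_cancel _ hU

/-- `(QGQ*)(U)·(QGQ*)⁻¹(U) = 1` wherever `(QGQ*)(U)` is invertible. [cite: Balaban1985BackgroundPropagators, (3.123) p.420] -/
theorem QGQY_mul_QGQinvY (hU : IsUnit (QGQY i parS parB Gp U)) : QGQY i parS parB Gp U * QGQinvY i parS parB Gp U = 1 :=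
  Ring.mul_inverse_cancel _ hU

/-- `(QGQ*)⁻¹(U)·(QGQ*)(U) = 1` wherever `(QGQ*)(U)` is invertible. [cite: Balaban1985BackgroundPropagators, (3.123) p.420] -/
theorem QGQinvY_mul_QGQY (hU : IsUnit (QGQY i parS parB Gp U)) : QGQinvY i parS parB Gp U * QGQY i parS parB Gp U = 1 :=
  Ring.inverse_mul_cancel _ hU

/-- where `(QGQ*)(U)` is not a unit the letter reads `0` (the `Ring.inverse` convention of the family). [cite: Balaban1985BackgroundPropagators, (3.123) p.420, bookkeeping] -/
theorem QGQinvY_of_not_isUnit (hU : ¬IsUnit (QGQY i parS parB Gp U)) : QGQinvY i parS parB Gp U = 0 :=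
  Ring.inverse_non_unit _ hU

/-- **`Q(U) ∘ H(U) = 1` wherever `(QGQ*)(U)` is a unit**: `H` solves the constraint `QA = B` of (3.110) («hence A = G̃Q*ω, QG̃Q*ω = B»).
[cite: Balaban1985BackgroundPropagators, (3.110) p.417, (3.123) p.420, (3.126) p.420] -/
theorem QY_comp_HDY (hU : IsUnit (QGQY i parS parB Gp U)) : QY i parB U ∘ₗ HDY i parS parB Gp U = LinearMap.id := by
  have h : QGQY i parS parB Gp U * QGQinvY i parS parB Gp U = 1 := Ring.mul_inverse_cancel _ hU
  rw [Module.End.mul_eq_comp, Module.End.one_eq_id, QGQY] at h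
  rw [HDY, ← h]
  simp only [LinearMap.comp_assoc]

end Letters

/-! ## §3 At `U = 1`: `Δ_π(1) = Δ(1)`, `G̃⁻¹(1) = Δ_a(1)`, `G(1) = G_A(1) = Gop♯` -/

section AtOne

variable (i : KIdx d ℓ hd hL b₀ b₁)
variable {parS : SiteParY 𝔸 i} {parB : BondParY 𝔸 i} {Gp : SiteOpY 𝔸 i}

/-- at `U = 1`, `1 − DG′RD*` is the lift of the flat kernel `1 − ∂♯G′♯R♯∂*♯`. [cite: Balaban1985BackgroundPropagators, (3.119) p.419, p.395 (U = 1), bookkeeping] -/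
theorem gaugePiY_one (hparS : ∀ z w, parS (fun _ _ => 1) z w = 1)
    (hGp : ∀ (f : SiteY i → ℝ) (E : 𝔸), Gp (fun _ _ => 1) (liftY f E) = liftY ((toKT i).G *ᵥ f) E) :
    gaugePiY i parS Gp (fun _ _ => 1) = liftMatY 𝔸 (1 - gradK i * gpK i * rK i * divK i) := by
  rw [gaugePiY, gradY_one, divY_one, RY_one i hparS hGp, Gp_one_eq_liftMatY hGp, ← liftMatY_mul, ← liftMatY_mul, ← liftMatY_mul,
    ← liftMatY_one 𝔸, ← liftMatY_sub]
  simp only [Matrix.mul_assoc]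

/-- at `U = 1`, `1 − DRG′D*` is the lift of `1 − ∂♯R♯G′♯∂*♯`. [cite: Balaban1985BackgroundPropagators, (3.119) p.419, p.395 (U = 1), bookkeeping] -/
theorem gaugePiTY_one (hparS : ∀ z w, parS (fun _ _ => 1) z w = 1)
    (hGp : ∀ (f : SiteY i → ℝ) (E : 𝔸), Gp (fun _ _ => 1) (liftY f E) = liftY ((toKT i).G *ᵥ f) E) :
    gaugePiTY i parS Gp (fun _ _ => 1) = liftMatY 𝔸 (1 - gradK i * rK i * gpK i * divK i) := by
  rw [gaugePiTY, gradY_one, divY_one, RY_one i hparS hGp, Gp_one_eq_liftMatY hGp, ← liftMatY_mul, ← liftMatY_mul, ← liftMatY_mul,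
    ← liftMatY_one 𝔸, ← liftMatY_sub]
  simp only [Matrix.mul_assoc]

/-- the flat matrix identity behind `Δ_π(1) = Δ(1)`: `(1 − ∂R♯G′♯∂*)(∂ᶜ*∂ᶜ)(1 − ∂G′♯R♯∂*) = ∂ᶜ*∂ᶜ` from `∂ᶜ∂ = 0`, `∂*∂ᶜ* = 0`.
[cite: Balaban1984PropagatorsII, (2.5)–(2.7) p.224, (2.32) p.227; Balaban1985BackgroundPropagators, (3.119) p.419] -/
theorem flat_deltaPi_matrix :
    (1 - gradK i * rK i * gpK i * divK i) * (cocurlK i * curlK i * (1 - gradK i * gpK i * rK i * divK i)) = cocurlK i * curlK i := by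
  have hcur : curlK i * (gradK i * gpK i * rK i * divK i) = 0 := by
    rw [← Matrix.mul_assoc, ← Matrix.mul_assoc, ← Matrix.mul_assoc, curlK_mul_gradK, Matrix.zero_mul, Matrix.zero_mul, Matrix.zero_mul]
  have hdiv : gradK i * rK i * gpK i * divK i * cocurlK i = 0 := by
    rw [Matrix.mul_assoc, divK_mul_cocurlK, Matrix.mul_zero]
  have h1 : cocurlK i * curlK i * (1 - gradK i * gpK i * rK i * divK i) = cocurlK i * curlK i := by
    rw [Matrix.mul_sub, Matrix.mul_one, Matrix.mul_assoc, hcur, Matrix.mul_zero, sub_zero]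
  rw [h1, Matrix.sub_mul, Matrix.one_mul, ← Matrix.mul_assoc (gradK i * rK i * gpK i * divK i) (cocurlK i) (curlK i), hdiv,
    Matrix.zero_mul, sub_zero]

/-- ★★ **`Δ_π(1) = Δ(1)`: AT `U = 1` THE GAUGE-INVARIANT EXTENSION OF THE HESSIAN FORM IS THE HESSIAN FORM** — `Δ(1) = ∂ᶜ*♯∂ᶜ♯`
(`hessY_one`) is already invariant under `A ↦ A − ∂λ` because `∂ᶜ∂ = 0` (and `∂*∂ᶜ* = 0` kills the left correction).
[cite: Balaban1985BackgroundPropagators, (3.119) p.419, p.395 («coincides … if U = 1»); Balaban1984PropagatorsII, (2.5)–(2.7) p.224] -/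
theorem deltaPiY_one (hparS : ∀ z w, parS (fun _ _ => 1) z w = 1)
    (hGp : ∀ (f : SiteY i → ℝ) (E : 𝔸), Gp (fun _ _ => 1) (liftY f E) = liftY ((toKT i).G *ᵥ f) E) :
    deltaPiY i parS Gp (fun _ _ => 1) = hessY i (fun _ _ => 1) := by
  rw [deltaPiY, gaugePiTY_one i hparS hGp, gaugePiY_one i hparS hGp, hessY_one, ← liftMatY_mul, ← liftMatY_mul, ← liftMatY_mul,
    flat_deltaPi_matrix]

/-- **`G̃⁻¹(1) = Δ_a(1)`**: at `U = 1` print's (3.122) operator is the (3.26) operator (hence r03's `Δ_a` of (2.19), `deltaAY_one`).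
[cite: Balaban1985BackgroundPropagators, (3.122) p.420, (3.26) p.395, p.395 («coincides with Δ_a in (2.19) if U = 1»)] -/
theorem deltaPiAY_one (hparS : ∀ z w, parS (fun _ _ => 1) z w = 1)
    (hGp : ∀ (f : SiteY i → ℝ) (E : 𝔸), Gp (fun _ _ => 1) (liftY f E) = liftY ((toKT i).G *ᵥ f) E) :
    deltaPiAY i parS parB Gp (fun _ _ => 1) = deltaAY i parS parB Gp (fun _ _ => 1) := by
  rw [deltaPiAY, deltaAY, deltaPiY_one i hparS hGp]

/-- `G̃⁻¹(1)` is invertible (it is `Δ_a(1)`, the lift of r03's bijective `Δ_a`). [cite: Balaban1985BackgroundPropagators, (3.122) p.420, Thm 3.12 p.423 (U = 1 case), bookkeeping] -/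
theorem isUnit_deltaPiAY_one (hparS : ∀ z w, parS (fun _ _ => 1) z w = 1) (hparB : ∀ s s', parB (fun _ _ => 1) s s' = 1)
    (hGp : ∀ (f : SiteY i → ℝ) (E : 𝔸), Gp (fun _ _ => 1) (liftY f E) = liftY ((toKT i).G *ᵥ f) E) :
    IsUnit (deltaPiAY i parS parB Gp (fun _ _ => 1)) := by
  rw [deltaPiAY_one i hparS hGp]
  exact isUnit_deltaAY_one i hparS hparB hGp

/-- ★ **`G(1) = G_A(1)`**: at `U = 1` Sect. D's `G = G̃` IS Sect. A's `G = Δ_a⁻¹` (print's `G₀`), as operators.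
[cite: Balaban1985BackgroundPropagators, (3.122) p.420, (3.27) p.395, (3.130) p.421] -/
theorem GDY_one (hparS : ∀ z w, parS (fun _ _ => 1) z w = 1)
    (hGp : ∀ (f : SiteY i → ℝ) (E : 𝔸), Gp (fun _ _ => 1) (liftY f E) = liftY ((toKT i).G *ᵥ f) E) :
    GDY i parS parB Gp (fun _ _ => 1) = GAY i parS parB Gp (fun _ _ => 1) := by
  show Ring.inverse (deltaPiAY i parS parB Gp fun _ _ => 1) = Ring.inverse (deltaAY i parS parB Gp fun _ _ => 1)
  rw [deltaPiAY_one i hparS hGp]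

/-- ★ **`G(1) = Gop♯`**: Sect. D's `G` at `U = 1` is the lift of r03's `Gop = Δ_a⁻¹` of (2.129) (`GAY_one`).
[cite: Balaban1985BackgroundPropagators, (3.122) p.420, Cor. 3.5 p.407 («for U = 1 … proved in [4]»); Balaban1984PropagatorsII, (2.129) p.245] -/
theorem GDY_one_liftEndY (hparS : ∀ z w, parS (fun _ _ => 1) z w = 1) (hparB : ∀ s s', parB (fun _ _ => 1) s s' = 1)
    (hGp : ∀ (f : SiteY i → ℝ) (E : 𝔸), Gp (fun _ _ => 1) (liftY f E) = liftY ((toKT i).G *ᵥ f) E) :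
    GDY i parS parB Gp (fun _ _ => 1) = liftEndY 𝔸 (Gop i) := by
  rw [GDY_one i hparS hGp]
  exact GAY_one i hparS hparB hGp

/-- **THE `U = 1` CLAUSE SHAPE FOR SECT. D's `G`**: `G(1)(J ⊗ E) = (Gop J) ⊗ E` on product-form arguments (the shape of `CovLettersY.GA_one`,
for the letter `GD`). [cite: Balaban1985BackgroundPropagators, (3.122) p.420, Cor. 3.5 p.407] -/
theorem GDY_one_liftY (hparS : ∀ z w, parS (fun _ _ => 1) z w = 1) (hparB : ∀ s s', parB (fun _ _ => 1) s s' = 1)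
    (hGp : ∀ (f : SiteY i → ℝ) (E : 𝔸), Gp (fun _ _ => 1) (liftY f E) = liftY ((toKT i).G *ᵥ f) E) (J : FBondY i → ℝ) (E : 𝔸) :
    GDY i parS parB Gp (fun _ _ => 1) (liftY J E) = liftY (Gop i J) E := by
  rw [GDY_one i hparS hGp]
  exact GAY_one_liftY i hparS hparB hGp J E

/-- **`(QGQ*)(1)` IS THE LIFT OF THE FLAT `Q♯ · [Gop] · Q*♯`** (r03's bond averaging, its adjoint, and the matrix of `Gop`).
[cite: Balaban1985BackgroundPropagators, (3.123) p.420, Cor. 3.5 p.407; Balaban1984PropagatorsII, (2.35) p.228, (2.129) p.245] -/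
theorem QGQY_one (hparS : ∀ z w, parS (fun _ _ => 1) z w = 1) (hparB : ∀ s s', parB (fun _ _ => 1) s s' = 1)
    (hGp : ∀ (f : SiteY i → ℝ) (E : 𝔸), Gp (fun _ _ => 1) (liftY f E) = liftY ((toKT i).G *ᵥ f) E) :
    QGQY i parS parB Gp (fun _ _ => 1) = liftMatY 𝔸 (qK i * LinearMap.toMatrix' (Gop i) * qsK i) := by
  rw [QGQY, QY_one i hparB, QsY_one i hparB, GDY_one_liftEndY i hparS hparB hGp, liftEndY_eq_liftMatY, ← liftMatY_mul, ← liftMatY_mul]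
  simp only [Matrix.mul_assoc]

/-- ★ **`(QGQ*)(1)` IS THE LIFT OF [4]'s `QGQ*` OF (2.35)** (r03's `qgqE = Q ∘ G ∘ Q*` on `ℓ²`, read on bond functions): print's Cor. 3.5 clause
«for U = 1 these theorems are proved in [4]» for the operator behind (3.132). [cite: Balaban1985BackgroundPropagators, (3.123) p.420, Cor. 3.5 p.407; Balaban1984PropagatorsII, (2.35) p.228] -/
theorem QGQY_one_liftEndY (hparS : ∀ z w, parS (fun _ _ => 1) z w = 1) (hparB : ∀ s s', parB (fun _ _ => 1) s s' = 1)
    (hGp : ∀ (f : SiteY i → ℝ) (E : 𝔸), Gp (fun _ _ => 1) (liftY f E) = liftY ((toKT i).G *ᵥ f) E) :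
    QGQY i parS parB Gp (fun _ _ => 1) = liftEndY 𝔸 (onFun (qgqE (domT i.hN i.D i.hk) i.hcf i.hw)) := by
  rw [QGQY_one i hparS hparB hGp, liftEndY_eq_liftMatY, qgqE, onFun_comp, onFun_comp, LinearMap.toMatrix'_comp,
    LinearMap.toMatrix'_comp]
  simp only [Matrix.mul_assoc]
  rfl

/-- `(QGQ*)(1)` on product forms: `(QGQ*)(1)(f ⊗ E) = (QGQ*f) ⊗ E` with [4]'s `QGQ*`. [cite: Balaban1985BackgroundPropagators, Cor. 3.5 p.407; Balaban1984PropagatorsII, (2.35) p.228] -/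
theorem QGQY_one_liftY (hparS : ∀ z w, parS (fun _ _ => 1) z w = 1) (hparB : ∀ s s', parB (fun _ _ => 1) s s' = 1)
    (hGp : ∀ (f : SiteY i → ℝ) (E : 𝔸), Gp (fun _ _ => 1) (liftY f E) = liftY ((toKT i).G *ᵥ f) E) (f : IBondY i → ℝ) (E : 𝔸) :
    QGQY i parS parB Gp (fun _ _ => 1) (liftY f E) = liftY (onFun (qgqE (domT i.hN i.D i.hk) i.hcf i.hw) f) E := by
  rw [QGQY_one_liftEndY i hparS hparB hGp, liftEndY_liftY]

/-- [4]'s `QGQ*` read on bond functions is a unit, with two-sided inverse r03's `EE = (QGQ*)⁻¹` («an inverse is a well-defined and positive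
operator», [4] p. 228). [cite: Balaban1984PropagatorsII, (2.35) p.228] -/
theorem isUnit_onFun_qgqE : IsUnit (onFun (qgqE (domT i.hN i.D i.hk) i.hcf i.hw)) := by
  refine isUnit_iff_exists.2 ⟨onFun (EE (domT i.hN i.D i.hk) i.hcf i.hw), ?_, ?_⟩
  · rw [Module.End.mul_eq_comp, ← onFun_comp, qgqE, comp_EE, onFun_id, Module.End.one_eq_id]
  · rw [Module.End.mul_eq_comp, ← onFun_comp, qgqE, EE_comp, onFun_id, Module.End.one_eq_id]

/-- ★ **`(QGQ*)(1)` IS INVERTIBLE** — so at `U = 1` the letter `(QGQ*)⁻¹ = Ring.inverse (QGQ*)` is the GENUINE inverse (as def-Y's `XinvY_one` for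
`(Q′G′²Q′*)⁻¹`). [cite: Balaban1985BackgroundPropagators, (3.123) p.420, Cor. 3.5 p.407; Balaban1984PropagatorsII, (2.35) p.228 («an inverse is a well-defined … operator»)] -/
theorem isUnit_QGQY_one (hparS : ∀ z w, parS (fun _ _ => 1) z w = 1) (hparB : ∀ s s', parB (fun _ _ => 1) s s' = 1)
    (hGp : ∀ (f : SiteY i → ℝ) (E : 𝔸), Gp (fun _ _ => 1) (liftY f E) = liftY ((toKT i).G *ᵥ f) E) :
    IsUnit (QGQY i parS parB Gp (fun _ _ => 1)) := by
  rw [QGQY_one_liftEndY i hparS hparB hGp]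
  exact isUnit_liftEndY 𝔸 (isUnit_onFun_qgqE i)

/-- ★★ **`(QGQ*)⁻¹(1)` IS THE LIFT OF [4]'s `(QGQ*)⁻¹` OF (2.35)** (r03's `EE`, read on bond functions): the `U = 1` identification of ROW 26's
letter with the [B6] object, by n06-g's clause-transfer engine `eq_liftEndY_of_ringInverse`. [cite: Balaban1985BackgroundPropagators, (3.132) p.422, Cor. 3.5 p.407 («for U = 1 … proved in [4]»); Balaban1984PropagatorsII, (2.35) p.228] -/
theorem QGQinvY_one_liftEndY (hparS : ∀ z w, parS (fun _ _ => 1) z w = 1) (hparB : ∀ s s', parB (fun _ _ => 1) s s' = 1)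
    (hGp : ∀ (f : SiteY i → ℝ) (E : 𝔸), Gp (fun _ _ => 1) (liftY f E) = liftY ((toKT i).G *ᵥ f) E) :
    QGQinvY i parS parB Gp (fun _ _ => 1) = liftEndY 𝔸 (onFun (EE (domT i.hN i.D i.hk) i.hcf i.hw)) :=
  eq_liftEndY_of_ringInverse (O₁ := QGQinvY i parS parB Gp fun _ _ => 1) (Δ₁ := QGQY i parS parB Gp fun _ _ => 1)
    (T := onFun (qgqE (domT i.hN i.D i.hk) i.hcf i.hw)) (S := onFun (EE (domT i.hN i.D i.hk) i.hcf i.hw)) rfl (isUnit_onFun_qgqE i)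
    (by rw [← onFun_comp, qgqE, comp_EE, onFun_id]) (QGQY_one_liftY i hparS hparB hGp)

/-- **THE `U = 1` CLAUSE SHAPE FOR THE LETTER `(QGQ*)⁻¹`**: `(QGQ*)⁻¹(1)(f ⊗ E) = ((QGQ*)⁻¹f) ⊗ E` with [4]'s `(QGQ*)⁻¹`.
[cite: Balaban1985BackgroundPropagators, (3.132) p.422, Cor. 3.5 p.407; Balaban1984PropagatorsII, (2.35) p.228] -/
theorem QGQinvY_one_liftY (hparS : ∀ z w, parS (fun _ _ => 1) z w = 1) (hparB : ∀ s s', parB (fun _ _ => 1) s s' = 1)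
    (hGp : ∀ (f : SiteY i → ℝ) (E : 𝔸), Gp (fun _ _ => 1) (liftY f E) = liftY ((toKT i).G *ᵥ f) E) (f : IBondY i → ℝ) (E : 𝔸) :
    QGQinvY i parS parB Gp (fun _ _ => 1) (liftY f E) = liftY (onFun (EE (domT i.hN i.D i.hk) i.hcf i.hw) f) E := by
  rw [QGQinvY_one_liftEndY i hparS hparB hGp, liftEndY_liftY]

/-- ★ **`H(1)` IS THE LIFT OF [4]'s `H = GQ*(QGQ*)⁻¹` OF (2.35)∕(2.130)** (the operator of `B6Cor28KLevelV1.QE_comp_H ∕ H_entry_le`, [4] Cor. 2.8),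
as a rectangular lift. [cite: Balaban1985BackgroundPropagators, (3.126) p.420, Cor. 3.5 p.407; Balaban1984PropagatorsII, (2.35) p.228, (2.130) p.246] -/
theorem HDY_one (hparS : ∀ z w, parS (fun _ _ => 1) z w = 1) (hparB : ∀ s s', parB (fun _ _ => 1) s s' = 1)
    (hGp : ∀ (f : SiteY i → ℝ) (E : 𝔸), Gp (fun _ _ => 1) (liftY f E) = liftY ((toKT i).G *ᵥ f) E) :
    HDY i parS parB Gp (fun _ _ => 1) = liftMatY 𝔸 (LinearMap.toMatrix'
      (Gop i ∘ₗ onFun (B6SectAOperatorsV1.QsE (domT i.hN i.D i.hk)) ∘ₗ onFun (EE (domT i.hN i.D i.hk) i.hcf i.hw))) := by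
  rw [HDY, GDY_one_liftEndY i hparS hparB hGp, QsY_one i hparB, QGQinvY_one_liftEndY i hparS hparB hGp, liftEndY_eq_liftMatY,
    liftEndY_eq_liftMatY, ← liftMatY_mul, ← liftMatY_mul, LinearMap.toMatrix'_comp, LinearMap.toMatrix'_comp]
  rfl

end AtOne

/-! ## §4 The record update `withSectD` and the letters `lettersYSectD` -/

section Upgrade

variable (𝔸) {x : MemberY d ℓ hd hL b₀ b₁ Mstar}

/-- **REPLACING `GD`, `QGQinv`, `H` BY THE GENUINE SECT. D LETTERS** built over the record's own transporters `parS ∕ parB` and its `G′`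
letter `Gp`: `GD := G(U) = G̃(U)` (3.122), `QGQinv := (QGQ*)⁻¹(U)` (3.123)∕(3.132), `H := G Q* (QGQ*)⁻¹` (3.126); every other field (the
transporters, `Gp GA C`, the printed clauses, and the letters `G₁ H₁ QG1Qinv GG Kdiff Ck P349`) is kept.
[cite: Balaban1985BackgroundPropagators, (3.122)–(3.126) p.420, (3.132) p.422] -/
def withSectD (𝔏 : CovLettersY 𝔸 x) : CovLettersY 𝔸 x :=
  { 𝔏 with
    GD := GDY x.toKIdx 𝔏.parS 𝔏.parB 𝔏.Gp
    QGQinv := QGQinvY x.toKIdx 𝔏.parS 𝔏.parB 𝔏.Gp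
    H := HDY x.toKIdx 𝔏.parS 𝔏.parB 𝔏.Gp }

variable {𝔸}
variable (𝔏 : CovLettersY 𝔸 x)

/-- the updated `GD` is Sect. D's `G`. [cite: Balaban1985BackgroundPropagators, (3.122) p.420, bookkeeping] -/
theorem withSectD_GD : (withSectD 𝔸 𝔏).GD = GDY x.toKIdx 𝔏.parS 𝔏.parB 𝔏.Gp := rfl

/-- the updated `QGQinv` is the genuine `(QGQ*)⁻¹(U)`. [cite: Balaban1985BackgroundPropagators, (3.132) p.422, bookkeeping] -/
theorem withSectD_QGQinv : (withSectD 𝔸 𝔏).QGQinv = QGQinvY x.toKIdx 𝔏.parS 𝔏.parB 𝔏.Gp := rfl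

/-- the updated `H` is `GQ*(QGQ*)⁻¹`. [cite: Balaban1985BackgroundPropagators, (3.126) p.420, bookkeeping] -/
theorem withSectD_H : (withSectD 𝔸 𝔏).H = HDY x.toKIdx 𝔏.parS 𝔏.parB 𝔏.Gp := rfl

/-- the update keeps `G′`. [cite: Balaban1985BackgroundPropagators, (3.25) p.395, bookkeeping] -/
theorem withSectD_Gp : (withSectD 𝔸 𝔏).Gp = 𝔏.Gp := rfl

/-- the update keeps `G_A`. [cite: Balaban1985BackgroundPropagators, (3.27) p.395, bookkeeping] -/
theorem withSectD_GA : (withSectD 𝔸 𝔏).GA = 𝔏.GA := rfl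

/-- the update keeps `C`. [cite: Balaban1985BackgroundPropagators, (3.48) p.398, bookkeeping] -/
theorem withSectD_C : (withSectD 𝔸 𝔏).C = 𝔏.C := rfl

/-- the update keeps the site transporter. [cite: Balaban1985BackgroundPropagators, (3.40) p.397, bookkeeping] -/
theorem withSectD_parS : (withSectD 𝔸 𝔏).parS = 𝔏.parS := rfl

/-- the update keeps the bond transporter. [cite: Balaban1985BackgroundPropagators, (3.40) p.397, bookkeeping] -/
theorem withSectD_parB : (withSectD 𝔸 𝔏).parB = 𝔏.parB := rfl

/-- the update keeps `(QG₁Q*)⁻¹` (still whatever `𝔏` had — the flat placeholder at the record). [cite: Balaban1985BackgroundPropagators, (3.132) p.422, bookkeeping] -/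
theorem withSectD_QG1Qinv : (withSectD 𝔸 𝔏).QG1Qinv = 𝔏.QG1Qinv := rfl

/-- the update keeps `G₁`. [cite: Balaban1985BackgroundPropagators, (3.128) p.421, bookkeeping] -/
theorem withSectD_G₁ : (withSectD 𝔸 𝔏).G₁ = 𝔏.G₁ := rfl

/-- the update keeps `H₁`. [cite: Balaban1985BackgroundPropagators, (3.129) p.421, bookkeeping] -/
theorem withSectD_H₁ : (withSectD 𝔸 𝔏).H₁ = 𝔏.H₁ := rfl

/-- the update keeps `P`. [cite: Balaban1985BackgroundPropagators, (3.49) p.399, bookkeeping] -/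
theorem withSectD_P349 : (withSectD 𝔸 𝔏).P349 = 𝔏.P349 := rfl

variable (𝔸) (x)

/-- **def-Y's v2 family WITH the genuine Sect. D letters of rows 20 ∕ 26** at a member. [cite: Balaban1985BackgroundPropagators, (3.25)–(3.27) p.395, (3.122)–(3.126) p.420, (3.132) p.422] -/
def covLettersY_v2D : CovLettersY 𝔸 x := withSectD 𝔸 (covLettersY_v2 𝔸 x)

/-- its `(QGQ*)⁻¹` is the genuine letter over the taxicab transporters and `G′ = GpY`. [cite: Balaban1985BackgroundPropagators, (3.132) p.422, bookkeeping] -/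
theorem covLettersY_v2D_QGQinv : (covLettersY_v2D 𝔸 x).QGQinv =
    QGQinvY x.toKIdx (parSY x.toKIdx) (parBY x.toKIdx) (GpY x.toKIdx (parSY x.toKIdx)) := rfl

/-- its `GD` is Sect. D's `G` over the taxicab transporters and `G′ = GpY`. [cite: Balaban1985BackgroundPropagators, (3.122) p.420, bookkeeping] -/
theorem covLettersY_v2D_GD : (covLettersY_v2D 𝔸 x).GD =
    GDY x.toKIdx (parSY x.toKIdx) (parBY x.toKIdx) (GpY x.toKIdx (parSY x.toKIdx)) := rfl

/-- its `(QG₁Q*)⁻¹` is still the flat placeholder. [cite: Balaban1985BackgroundPropagators, (3.132) p.422, bookkeeping] -/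
theorem covLettersY_v2D_QG1Qinv : (covLettersY_v2D 𝔸 x).QG1Qinv = fun _ => 0 := rfl

end Upgrade

section RecordLetters

open scoped Matrix.Norms.L2Operator

variable {N : ℕ}

/-- ★ **THE LETTERS OF RECORD WITH THE GENUINE SECT. D LETTERS OF ROWS 20 ∕ 26**: `x ↦ withSectD (lettersYOfRecord N θ M⋆ x)`, `𝔸 = M_N(ℂ)`.
A name for the knit; whether def-Y's `lettersYOfRecord` is superseded by it is the owner's call. [cite: Balaban1985BackgroundPropagators, (3.122)–(3.126) p.420, (3.132) p.422] -/
def lettersYSectD (N : ℕ) (θ : Stage3Params) (Mstar : ℕ) : LettersY N θ Mstar :=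
  fun x => withSectD (Matrix (Fin N) (Fin N) ℂ) (lettersYOfRecord N θ Mstar x)

/-- at a member these are `covLettersY_v2D`. [cite: Balaban1985BackgroundPropagators, (3.132) p.422, bookkeeping] -/
theorem lettersYSectD_apply (θ : Stage3Params) (Mstar : ℕ) (x : MemberY θ.d₆ θ.ℓ₆ θ.hd' θ.hL' θ.b₀ θ.b₁ Mstar) :
    lettersYSectD N θ Mstar x = covLettersY_v2D (Matrix (Fin N) (Fin N) ℂ) x := rfl

/-- the `(QGQ*)⁻¹` letter of `lettersYSectD` is `U ↦ Ring.inverse ((QGQ*)(U))`. [cite: Balaban1985BackgroundPropagators, (3.132) p.422, bookkeeping] -/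
theorem lettersYSectD_QGQinv (θ : Stage3Params) (Mstar : ℕ) (x : MemberY θ.d₆ θ.ℓ₆ θ.hd' θ.hL' θ.b₀ θ.b₁ Mstar)
    (U : CfgY (Matrix (Fin N) (Fin N) ℂ) x.toKIdx) :
    (lettersYSectD N θ Mstar x).QGQinv U =
      Ring.inverse (QGQY x.toKIdx (parSY x.toKIdx) (parBY x.toKIdx) (GpY x.toKIdx (parSY x.toKIdx)) U) := rfl

/-- the `(QG₁Q*)⁻¹` letter of `lettersYSectD` is the flat placeholder. [cite: Balaban1985BackgroundPropagators, (3.132) p.422, bookkeeping] -/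
theorem lettersYSectD_QG1Qinv (θ : Stage3Params) (Mstar : ℕ) (x : MemberY θ.d₆ θ.ℓ₆ θ.hd' θ.hL' θ.b₀ θ.b₁ Mstar) :
    (lettersYSectD N θ Mstar x).QG1Qinv = fun _ => 0 := rfl

end RecordLetters

/-! ## §5 Row 26 at these letters: the `(QGQ*)⁻¹` half from two estimate binders, the `(QG₁Q*)⁻¹` half flat -/

section Halves

variable {I : Type} {d : ℕ} {c35 : ℝ} {geo : I → B9.Geometry} {bg : I → B9.Backgrounds}

/-- **ONE HALF OF (3.132)**: the family statement `B9.Stmt3132Printed` for ONE kernel — under the printed prefix of Thm 3.12 (M ≧ M₄,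
0 < α₀, Mα₀ ≦ a₀, U in (3.35) ∩ (3.36)) the display `B9.Ineq3132 d (K i) C δ₁ U`. [cite: Balaban1985BackgroundPropagators, (3.132) p.422 («and the same for the operator with G₁ instead of G»)] -/
def Half3132 (d : ℕ) (c35 : ℝ) (geo : I → B9.Geometry) (bg : I → B9.Backgrounds) (K : ∀ i, B9.SiteKernel (geo i) (bg i)) : Prop :=
  ∃ M₄ δ₁ a₀ C : ℝ, 0 < M₄ ∧ 0 < δ₁ ∧ 0 < a₀ ∧ 0 < C ∧
    ∀ i : I, M₄ ≤ (geo i).M → ∀ α₀ : ℝ, 0 < α₀ → (geo i).M * α₀ ≤ a₀ →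
      ∀ U : (bg i).Cfg, (bg i).Reg335 c35 α₀ U → (bg i).Reg336 c35 α₀ U → B9.Ineq3132 d (K i) C δ₁ U

/-- the `(QGQ*)⁻¹` half of the printed statement. [cite: Balaban1985BackgroundPropagators, (3.132) p.422, bookkeeping] -/
theorem half3132_left {K K₁ : ∀ i, B9.SiteKernel (geo i) (bg i)} (h : B9.Stmt3132Printed d c35 geo bg K K₁) :
    Half3132 d c35 geo bg K := by
  obtain ⟨M₄, δ₁, a₀, C, hM, hδ, ha, hC, H⟩ := h
  exact ⟨M₄, δ₁, a₀, C, hM, hδ, ha, hC, fun i hMi α₀ hα₀ hMa U hU hU' => (H i hMi α₀ hα₀ hMa U hU hU').1⟩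

/-- the `(QG₁Q*)⁻¹` half of the printed statement. [cite: Balaban1985BackgroundPropagators, (3.132) p.422, bookkeeping] -/
theorem half3132_right {K K₁ : ∀ i, B9.SiteKernel (geo i) (bg i)} (h : B9.Stmt3132Printed d c35 geo bg K K₁) :
    Half3132 d c35 geo bg K₁ := by
  obtain ⟨M₄, δ₁, a₀, C, hM, hδ, ha, hC, H⟩ := h
  exact ⟨M₄, δ₁, a₀, C, hM, hδ, ha, hC, fun i hMi α₀ hα₀ hMa U hU hU' => (H i hMi α₀ hα₀ hMa U hU hU').2⟩

/-- **THE TWO HALVES GIVE THE PRINTED STATEMENT** («of course with different constants»: M₄ := max, a₀ := min, δ₁ := min, C := max; needs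
`L^jη ≧ 0` and `d ≧ 0` for the monotonicity `ineq3132_mono`). [cite: Balaban1985BackgroundPropagators, (3.132) p.422 (bookkeeping: merging the constants of the two displays)] -/
theorem stmt3132Printed_of_halves {K K₁ : ∀ i, B9.SiteKernel (geo i) (bg i)}
    (hlen : ∀ (i : I) (y : (geo i).Site), 0 ≤ (geo i).len y) (hdist : ∀ (i : I) (y y' : (geo i).Site), 0 ≤ (geo i).dist y y')
    (h : Half3132 d c35 geo bg K) (h₁ : Half3132 d c35 geo bg K₁) : B9.Stmt3132Printed d c35 geo bg K K₁ := by
  obtain ⟨M₄, δ₁, a₀, C, hM, hδ, ha, hC, H⟩ := h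
  obtain ⟨M₄', δ₁', a₀', C', hM', hδ', ha', hC', H'⟩ := h₁
  refine ⟨max M₄ M₄', min δ₁ δ₁', min a₀ a₀', max C C', lt_max_of_lt_left hM, lt_min hδ hδ', lt_min ha ha', lt_max_of_lt_left hC, ?_⟩
  intro i hMi α₀ hα₀ hMa U hU hU'
  have hCC : 0 ≤ max C C' := (lt_max_of_lt_left hC).le
  exact ⟨ineq3132_mono d (hlen i) (hdist i) (H i (le_trans (le_max_left _ _) hMi) α₀ hα₀ (le_trans hMa (min_le_left _ _)) U hU hU')
      (le_max_left _ _) hCC (min_le_left _ _),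
    ineq3132_mono d (hlen i) (hdist i) (H' i (le_trans (le_max_right _ _) hMi) α₀ hα₀ (le_trans hMa (min_le_right _ _)) U hU hU')
      (le_max_right _ _) hCC (min_le_right _ _)⟩

/-- a kernel that reads `0` identically satisfies its half outright (C = δ₁ = 1) — the VACUOUS half of a flat letter.
[cite: Balaban1985BackgroundPropagators, (3.132) p.422 (statement shape; vacuity bookkeeping)] -/
theorem half3132_of_ker_zero (d : ℕ) (c35 : ℝ) (K : ∀ i, B9.SiteKernel (geo i) (bg i)) (hK : ∀ i U y y', (K i).ker U y y' = 0)
    (hlen : ∀ (i : I) (y : (geo i).Site), 0 ≤ (geo i).len y) : Half3132 d c35 geo bg K :=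
  half3132_left (stmt3132Printed_of_ker_zero d c35 K K hK hK hlen)

end Halves

section Record

variable (G : Subgroup 𝔸ˣ)
variable {Ff : Type} [Fintype Ff] [DecidableEq Ff] (b : Module.Basis Ff ℝ 𝔸)

/-- **THE `(QGQ*)⁻¹`-TYPE HALF AT THE RECORD GEOMETRY FOR AN INVERSE LETTER, FROM ITS TWO ESTIMATE BINDERS**: g4's
`stmt3132Printed_geo9Y_of_ringInverse` (p482854 §4) on the diagonal `T₁ := T`.  Coercivity and decay of the normalised real matrix
`normMatY b w (T x U)` (symmetric weights) REMAIN HYPOTHESES. [cite: Balaban1985BackgroundPropagators, (3.132) p.422 + Thm 3.12 p.423 (prefix); Balaban1984PropagatorsII, Lemma 2.1 (2.60)–(2.61) p.234] -/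
theorem half3132_geo9Y_of_ringInverse (dd : ℕ) [∀ x : MemberY d ℓ hd hL b₀ b₁ Mstar, Fintype (geo9Y x).Site]
    [∀ x : MemberY d ℓ hd hL b₀ b₁ Mstar, DecidableEq (geo9Y x).Site] {c35 : ℝ}
    (T : ∀ x : MemberY d ℓ hd hL b₀ b₁ Mstar, CfgY 𝔸 x.toKIdx → Module.End ℂ ((geo9Y x).Site → 𝔸))
    (hco : CoerciveUnder c35 (fun x => geoComap (geo9Y x) (Prod.fst : (geo9Y x).Site × Ff → (geo9Y x).Site)) (bg9Y 𝔸 G)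
      (fun x U => normMatY b (fun y => (geo9Y x).len y ^ (-(1 + (dd : ℝ) / 2))) (T x U)))
    (hdec : DecayUnder c35 (fun x => geoComap (geo9Y x) (Prod.fst : (geo9Y x).Site × Ff → (geo9Y x).Site)) (bg9Y 𝔸 G)
      (fun x U => normMatY b (fun y => (geo9Y x).len y ^ (-(1 + (dd : ℝ) / 2))) (T x U))) :
    Half3132 dd c35 (geo9Y (d := d) (ℓ := ℓ) (hd := hd) (hL := hL) (b₀ := b₀) (b₁ := b₁) (Mstar := Mstar)) (bg9Y 𝔸 G)
      (fun x => siteKernelOfOp x.toKIdx (bg9Y 𝔸 G x) (fun U => U) (fun U => Ring.inverse (T x U)) id id) :=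
  half3132_left (stmt3132Printed_geo9Y_of_ringInverse G b dd T T hco hdec hco hdec)

end Record

section OpsY

open scoped Matrix.Norms.L2Operator

variable {N : ℕ} {Ff : Type} [Fintype Ff] [DecidableEq Ff]

/-- the knit's (3.132) reading of the letters `x ↦ withSectD (𝔏 x)`: `(ops x).QGQinv` reads `U ↦ Ring.inverse ((QGQ*)(U))` over the record's
`parS, parB, Gp` (by `rfl`). [cite: Balaban1985BackgroundPropagators, (3.132) p.422, bookkeeping] -/
theorem opsYOfLetters_withSectD_QGQinv (θ : Stage3Params) (Mstar : ℕ) (𝔏 : LettersY N θ Mstar) (𝔈 : ExpsY N θ Mstar)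
    (x : MemberY θ.d₆ θ.ℓ₆ θ.hd' θ.hL' θ.b₀ θ.b₁ Mstar) :
    (opsYOfLetters N θ Mstar (fun x => withSectD (Matrix (Fin N) (Fin N) ℂ) (𝔏 x)) 𝔈 x).QGQinv =
      siteKernelOfOp x.toKIdx (bg9Y (Matrix (Fin N) (Fin N) ℂ) (specialUnitaryUnits (Fin N)) x) (fun U => U)
        (fun U => Ring.inverse (QGQY x.toKIdx (𝔏 x).parS (𝔏 x).parB (𝔏 x).Gp U)) id id := rfl

/-- the knit's (3.132) reading of the untouched `(QG₁Q*)⁻¹` letter of `x ↦ withSectD (𝔏 x)` is that of `𝔏`. [cite: Balaban1985BackgroundPropagators, (3.132) p.422, bookkeeping] -/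
theorem opsYOfLetters_withSectD_QG1Qinv (θ : Stage3Params) (Mstar : ℕ) (𝔏 : LettersY N θ Mstar) (𝔈 : ExpsY N θ Mstar)
    (x : MemberY θ.d₆ θ.ℓ₆ θ.hd' θ.hL' θ.b₀ θ.b₁ Mstar) :
    (opsYOfLetters N θ Mstar (fun x => withSectD (Matrix (Fin N) (Fin N) ℂ) (𝔏 x)) 𝔈 x).QG1Qinv =
      (opsYOfLetters N θ Mstar 𝔏 𝔈 x).QG1Qinv := rfl

/-- ★★ **ROW 26 OF THE N06 KNIT AT `x ↦ withSectD (𝔏 x)` — THE `(QGQ*)⁻¹` HALF FROM EXACTLY TWO ESTIMATE BINDERS, THE `(QG₁Q*)⁻¹` HALF AS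
DISPLAYED**: for ANY base family `𝔏` (def-Y's interface), at `ops := opsYOfLetters N θ M⋆ (x ↦ withSectD (𝔏 x)) 𝔈`, `s3132 : B9.Stmt3132Printed d′ c35
geo9Y (bg9Y …) (x ↦ (ops x).QGQinv) (x ↦ (ops x).QG1Qinv)` follows from `hco` (Thm 3.11-type COERCIVITY) and `hdec` (Thm 3.3-type DECAY) of the
normalised real matrix `normMatY b w ((QGQ*)(U))` of the GENUINE `(QGQ*)(U) = Q(U)G(U)Q*(U)` over Sect. D's `G` and the record's `parS, parB, Gp`
(symmetric weights `w(y) = (Lʲη)^{−(1+d′∕2)}`, any real basis `b` of `M_N(ℂ)`; g4's ring-inverse dictionary, `hT := rfl`), plus the displayed half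
`h₁ : Half3132 …` of `𝔏`'s own `(QG₁Q*)⁻¹` letter.  Honest: the estimates are hypotheses for good in this programme (print: «analyzed in the same
way as (Q′G′²Q′*)⁻¹», Sect. B, not typed); NOT a node discharge; count-neutral.
[cite: Balaban1985BackgroundPropagators, (3.132) p.422 + Thm 3.12 p.423 (prefix), (3.122)–(3.123) p.420; Balaban1984PropagatorsII, Lemma 2.1 (2.60)–(2.61) p.234] -/
theorem s3132_withSectD (θ : Stage3Params) (Mstar : ℕ) (𝔏 : LettersY N θ Mstar) (𝔈 : ExpsY N θ Mstar) (dd : ℕ) {c35 : ℝ}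
    [∀ x : MemberY θ.d₆ θ.ℓ₆ θ.hd' θ.hL' θ.b₀ θ.b₁ Mstar, Fintype (geo9Y x).Site]
    [∀ x : MemberY θ.d₆ θ.ℓ₆ θ.hd' θ.hL' θ.b₀ θ.b₁ Mstar, DecidableEq (geo9Y x).Site]
    (b : Module.Basis Ff ℝ (Matrix (Fin N) (Fin N) ℂ))
    (hco : CoerciveUnder c35
      (fun x : MemberY θ.d₆ θ.ℓ₆ θ.hd' θ.hL' θ.b₀ θ.b₁ Mstar => geoComap (geo9Y x) (Prod.fst : (geo9Y x).Site × Ff → (geo9Y x).Site))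
      (bg9Y (Matrix (Fin N) (Fin N) ℂ) (specialUnitaryUnits (Fin N)))
      (fun x U => normMatY b (fun y => (geo9Y x).len y ^ (-(1 + (dd : ℝ) / 2)))
        (QGQY x.toKIdx (𝔏 x).parS (𝔏 x).parB (𝔏 x).Gp U)))
    (hdec : DecayUnder c35
      (fun x : MemberY θ.d₆ θ.ℓ₆ θ.hd' θ.hL' θ.b₀ θ.b₁ Mstar => geoComap (geo9Y x) (Prod.fst : (geo9Y x).Site × Ff → (geo9Y x).Site))
      (bg9Y (Matrix (Fin N) (Fin N) ℂ) (specialUnitaryUnits (Fin N)))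
      (fun x U => normMatY b (fun y => (geo9Y x).len y ^ (-(1 + (dd : ℝ) / 2)))
        (QGQY x.toKIdx (𝔏 x).parS (𝔏 x).parB (𝔏 x).Gp U)))
    (h₁ : Half3132 dd c35 (geo9Y (d := θ.d₆) (ℓ := θ.ℓ₆) (hd := θ.hd') (hL := θ.hL') (b₀ := θ.b₀) (b₁ := θ.b₁) (Mstar := Mstar))
      (bg9Y (Matrix (Fin N) (Fin N) ℂ) (specialUnitaryUnits (Fin N)))
      (fun x => (opsYOfLetters N θ Mstar (fun x => withSectD (Matrix (Fin N) (Fin N) ℂ) (𝔏 x)) 𝔈 x).QG1Qinv)) :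
    B9.Stmt3132Printed dd c35 (geo9Y (d := θ.d₆) (ℓ := θ.ℓ₆) (hd := θ.hd') (hL := θ.hL') (b₀ := θ.b₀) (b₁ := θ.b₁) (Mstar := Mstar))
      (bg9Y (Matrix (Fin N) (Fin N) ℂ) (specialUnitaryUnits (Fin N)))
      (fun x => (opsYOfLetters N θ Mstar (fun x => withSectD (Matrix (Fin N) (Fin N) ℂ) (𝔏 x)) 𝔈 x).QGQinv)
      (fun x => (opsYOfLetters N θ Mstar (fun x => withSectD (Matrix (Fin N) (Fin N) ℂ) (𝔏 x)) 𝔈 x).QG1Qinv) := by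
  have e : (fun x => (opsYOfLetters N θ Mstar (fun x => withSectD (Matrix (Fin N) (Fin N) ℂ) (𝔏 x)) 𝔈 x).QGQinv) =
      fun x : MemberY θ.d₆ θ.ℓ₆ θ.hd' θ.hL' θ.b₀ θ.b₁ Mstar =>
        siteKernelOfOp x.toKIdx (bg9Y (Matrix (Fin N) (Fin N) ℂ) (specialUnitaryUnits (Fin N)) x) (fun U => U)
          (fun U => Ring.inverse (QGQY x.toKIdx (𝔏 x).parS (𝔏 x).parB (𝔏 x).Gp U)) id id := rfl
  rw [e]
  exact stmt3132Printed_of_halves (fun x y => (geo9Y_len_pos x y).le) (fun x y y' => geo9K_dist_nonneg' x.toKIdx y y')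
    (half3132_geo9Y_of_ringInverse (specialUnitaryUnits (Fin N)) b dd _ hco hdec) h₁

/-- ★★★ **ROW 26 OF THE N06 KNIT AT `lettersYSectD` (def-Y's letters of record WITH the genuine Sect. D letters), FROM EXACTLY TWO ESTIMATE
BINDERS**: at `ops := opsYOfLetters N θ M⋆ (lettersYSectD N θ M⋆) 𝔈`, `s3132 : B9.Stmt3132Printed d′ c35 geo9Y (bg9Y …) (x ↦ (ops x).QGQinv)
(x ↦ (ops x).QG1Qinv)` follows from `hco` (Thm 3.11-type COERCIVITY) and `hdec` (Thm 3.3-type DECAY) of the normalised real matrix of the GENUINE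
`(QGQ*)(U) = Q(U)G(U)Q*(U)` over the taxicab transporters and `G′ = GpY` (symmetric weights, any real basis `b` of `M_N(ℂ)`); the `(QG₁Q*)⁻¹` half is
the flat letter's (reads `0`: VACUOUS, LOCATED — `G₁` (3.128) needs `C^{(2)}` of [5] (149) and `J = D*η⁻² Im ∂U` of (3.12), not typed on NODE 00's
carriers).  Compare `B9RecordDELettersVacuity.s3132_opsYOfRecord_vacuous` (BOTH halves flat at `opsYOfRecord`).  Honest: the two estimates are
hypotheses for good (print's route = Sect. B, not typed); NOT a node discharge; count-neutral.
[cite: Balaban1985BackgroundPropagators, (3.132) p.422 + Thm 3.12 p.423 (prefix), (3.122)–(3.123) p.420; Balaban1984PropagatorsII, Lemma 2.1 (2.60)–(2.61) p.234] -/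
theorem s3132_lettersYSectD (θ : Stage3Params) (Mstar : ℕ) (𝔈 : ExpsY N θ Mstar) (dd : ℕ) {c35 : ℝ}
    [∀ x : MemberY θ.d₆ θ.ℓ₆ θ.hd' θ.hL' θ.b₀ θ.b₁ Mstar, Fintype (geo9Y x).Site]
    [∀ x : MemberY θ.d₆ θ.ℓ₆ θ.hd' θ.hL' θ.b₀ θ.b₁ Mstar, DecidableEq (geo9Y x).Site]
    (b : Module.Basis Ff ℝ (Matrix (Fin N) (Fin N) ℂ))
    (hco : CoerciveUnder c35
      (fun x : MemberY θ.d₆ θ.ℓ₆ θ.hd' θ.hL' θ.b₀ θ.b₁ Mstar => geoComap (geo9Y x) (Prod.fst : (geo9Y x).Site × Ff → (geo9Y x).Site))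
      (bg9Y (Matrix (Fin N) (Fin N) ℂ) (specialUnitaryUnits (Fin N)))
      (fun x U => normMatY b (fun y => (geo9Y x).len y ^ (-(1 + (dd : ℝ) / 2)))
        (QGQY x.toKIdx (parSY x.toKIdx) (parBY x.toKIdx) (GpY x.toKIdx (parSY x.toKIdx)) U)))
    (hdec : DecayUnder c35
      (fun x : MemberY θ.d₆ θ.ℓ₆ θ.hd' θ.hL' θ.b₀ θ.b₁ Mstar => geoComap (geo9Y x) (Prod.fst : (geo9Y x).Site × Ff → (geo9Y x).Site))
      (bg9Y (Matrix (Fin N) (Fin N) ℂ) (specialUnitaryUnits (Fin N)))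
      (fun x U => normMatY b (fun y => (geo9Y x).len y ^ (-(1 + (dd : ℝ) / 2)))
        (QGQY x.toKIdx (parSY x.toKIdx) (parBY x.toKIdx) (GpY x.toKIdx (parSY x.toKIdx)) U))) :
    B9.Stmt3132Printed dd c35 (geo9Y (d := θ.d₆) (ℓ := θ.ℓ₆) (hd := θ.hd') (hL := θ.hL') (b₀ := θ.b₀) (b₁ := θ.b₁) (Mstar := Mstar))
      (bg9Y (Matrix (Fin N) (Fin N) ℂ) (specialUnitaryUnits (Fin N)))
      (fun x => (opsYOfLetters N θ Mstar (lettersYSectD N θ Mstar) 𝔈 x).QGQinv)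
      (fun x => (opsYOfLetters N θ Mstar (lettersYSectD N θ Mstar) 𝔈 x).QG1Qinv) := by
  have hzero : ∀ (x : MemberY θ.d₆ θ.ℓ₆ θ.hd' θ.hL' θ.b₀ θ.b₁ Mstar)
      (U : (bg9Y (Matrix (Fin N) (Fin N) ℂ) (specialUnitaryUnits (Fin N)) x).Cfg) (y y' : (geo9Y x).Site),
      (opsYOfLetters N θ Mstar (lettersYSectD N θ Mstar) 𝔈 x).QG1Qinv.ker U y y' = 0 := by
    intro x U y y'
    have h1 : (opsYOfLetters N θ Mstar (lettersYSectD N θ Mstar) 𝔈 x).QG1Qinv =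
        siteKernelOfOp x.toKIdx (bg9Y (Matrix (Fin N) (Fin N) ℂ) (specialUnitaryUnits (Fin N)) x) (fun U => U)
          (lettersYSectD N θ Mstar x).QG1Qinv id id := rfl
    rw [h1, lettersYSectD_QG1Qinv]
    exact siteKernelOfOp_zero_ker x.toKIdx (bg9Y (Matrix (Fin N) (Fin N) ℂ) (specialUnitaryUnits (Fin N)) x) (fun U => U) id id U y y'
  exact s3132_withSectD θ Mstar (lettersYOfRecord N θ Mstar) 𝔈 dd b hco hdec
    (half3132_of_ker_zero dd c35 _ hzero (fun x y => (geo9Y_len_pos x y).le))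

end OpsY

end

end Literature.MathematicalPhysics.QuantumFieldTheory.Balaban1983to89.B9Eq3132SectDLetters
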